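import Summits.ABC.IUTFork.Joshi.InitialThetaDataJoshiProofs
import Literature.IUT.HodgeTheaters.InitialThetaDataQRootProofs
import HarnessLib

/-!
# [J-III] §3.4.1 «in particular, the Tate parameter of `C/L_v` has a `2ℓ`th-root in `L'_w`» — DISCHARGED at places of split multiplicative reduction

Proof-only companion (theorems only; no definition, no named fact, no instance) of
`Summits/ABC/IUTFork/Joshi/InitialThetaDataJoshi.lean` (abc-iut-E-t6, p428841; sequel of
`InitialThetaDataJoshiProofs.lean`, p430563; rung LADDER-ABC:A2.E, slot T-06). TAKES NO SIDE on [IUTchIII]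
Cor. 3.12 or on any author; typed ≠ proved. Source: K. Joshi, arXiv:2401.13508v4 = [J-III], §3.4.1 p.29 l.9–21:
«Let `w ∈ V^{odd,ss}` be a prime of `L'` lying over a prime `v ∈ V^{odd,ss}_L` of `L`. Then `C/L'_w` has a
non-trivial point of exact order `2·ℓ` defined over `L'_w` … In particular, if `w | v` for a prime `v | p` of `L`,
then the Tate parameter of `C/L_v` has an `2ℓ`th-root in `L'_w`.»

For Joshi's typed data `D : ATS3.InitialThetaData L L' Lbar C ℓ` ((1)–(14) of [J-III] §3.1/§3.3) this file proves,
replaying for Joshi's structure the tree's [IUTchI] Ex. 3.2 (iv) file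
`Literature.IUT.HodgeTheaters.InitialThetaDataQRootProofs` (abc-iut-w5-d209; every input a LANDED tree theorem):

* `two_torsion_rational`, `exists_finset_two_torsion` — by (10) the `2`-division cubic of `C` splits over `L` and
  `C(L')` contains `4` points killed by `2`;
* `exists_finset_l_torsion` — by (12)–(13) `C(L')` contains `ℓ²` points killed by `ℓ` (the `𝔽_ℓ`-basis of
  `C[ℓ](L̄)` descended to `L'`, `InitialThetaDataJoshiProofs.mem_range_map_of_l_torsion`);
* **`exists_pow_two_mul_l_eq_tateParameter`** — at a finite place `w` of `L'` where `C ×_L L'` has SPLIT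
  multiplicative reduction, the Tate parameter `q_w ∈ L'_w` of `C` (Silverman ATAEC V.5.3: `q_w ≠ 0`, `‖q_w‖ < 1`,
  `tateJ q_w = j(C)`; it is the Tate parameter of `C/L_v` viewed in `L'_w ⊇ L_v`, by uniqueness) is a `2ℓ`-th
  POWER: `q_w = r^{2ℓ}`, `r ∈ L'_w`, with `w(j(C)) = (w r)⁻¹^{2ℓ}` — the root `q̳ = q^{1/2ℓ}` the Θ-pilot values need
  (abc-iut-c312-5 `Thm311RealTate` ERRATUM R7-C5-F1). Mechanism: rational `n`-torsion of full rank on the Tate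
  curve `L'_w^×/q^ℤ` forces an `n`-th root of `q` (`exists_pow_eq_tateParameter_of_torsion_at`, `n = 2` and `n = ℓ`),
  combined by `gcd(2, ℓ) = 1` (`exists_pow_mul_eq_of_coprime`).

SPLITNESS (`hsplit`) is a HYPOTHESIS here, exactly as on the Mochizuki side: the statement file types [J-III] §3.2 (6)
«bad, semi-stable reduction i.e. split multiplicative reduction» in its MULTIPLICATIVE reading (`Voddss`), with the
author's gloss as the narrower `VoddSplitMod`; at a place of the gloss's kind `hsplit` holds by definition. That full
rational `ℓ`-torsion (`ℓ ≥ 3`) forces a multiplicative place to be split is classical but not in the tree (see the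
docstring of `InitialThetaDataQRootProofs`). The typed ι-form `InitialThetaData.TateParameterRootTwoL` (root of the
image of the `L_v`-Tate parameter under a posited continuous `ι : L_v → L'_w`) is NOT closed here (it needs the
transport `ι (tateJ q) = tateJ (ι q)`); this file gives the same root for the Tate parameter read in `L'_w`.
For the last theorem `L'` is in `Type` (the tree's `TorsionRootNumberField` is so typed). No new `Prop` fact.
[claim: Joshi2024ATS3, status: disputed]
-/

noncomputable section

open scoped Classical
open NumberField IsDedekindDomain WeierstrassCurve
open Literature.IUT.HodgeTheaters hiding InitialThetaData

universe u v w

namespace Summit.ABC.IUTFork.Joshi.ATS3.InitialThetaData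

/-! ## Full `2`- and `ℓ`-torsion of `C` over `L'` -/

section Torsion

variable {L : Type u} {L' : Type v} {Lbar : Type w} [Field L] [NumberField L] [Field L'] [NumberField L']
  [Algebra L L'] [Field Lbar] [Algebra L Lbar] [Algebra L' Lbar] {C : WeierstrassCurve L} [C.IsElliptic]
  {ℓ : ℕ} (D : InitialThetaData L L' Lbar C ℓ)

include D

/-- The points of order `2` of `C(L̄)` are `L`-rational ((10): the `6`-torsion is; `6•T = 3•(2•T)`).
[claim: Joshi2024ATS3, status: disputed] -/
theorem two_torsion_rational (T : GeomPoints Lbar C) (hT : (2 : ℤ) • T = 0) :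
    T ∈ Set.range (Affine.Point.baseChange (W' := C.toAffine) L Lbar) := by
  refine D.torsion_six_rational T ?_
  rw [show (6 : ℤ) = 3 * 2 by norm_num, mul_smul, hT, smul_zero]

/-- **`C(L')` has full `2`-torsion**: four distinct points killed by `2` (`O` and the three points of order `2`, whose
abscissae are the roots of the `2`-division cubic — distinct, and `L`-rational by (10)). Replay of the tree's
`Literature.IUT.HodgeTheaters.InitialThetaData.exists_finset_two_torsion`. [claim: Joshi2024ATS3, status: disputed] -/
theorem exists_finset_two_torsion [IsScalarTower L L' Lbar] :
    ∃ S : Finset (C.toAffine.baseChange L').Point, S.card = 4 ∧ ∀ P ∈ S, 2 • P = 0 := by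
  haveI := D.isAlgClosure
  haveI : IsAlgClosed Lbar := IsAlgClosure.isAlgClosed L
  haveI : CharZero Lbar := charZero_of_injective_algebraMap (algebraMap L Lbar).injective
  haveI : (C.baseChange Lbar).IsElliptic := inferInstanceAs (C.map (algebraMap L Lbar)).IsElliptic
  set j : (C.toAffine.baseChange L').Point →+ (C.toAffine.baseChange Lbar).Point :=
    Affine.Point.map (W' := C.toAffine) (IsScalarTower.toAlgHom L L' Lbar) with hj
  have hjinj : Function.Injective j := Affine.Point.map_injective _
  obtain ⟨e₁, e₂, e₃, h3⟩ := C.exists_roots_eq_of_two_torsion_rational (Kbar := Lbar) D.two_torsion_rational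
  obtain ⟨h12, h13, h23⟩ := C.roots_ne_of_roots_eq h3
  -- the mapped cubic is the `2`-division cubic of `C/L̄`
  have hmap : Cubic.map (algebraMap L Lbar) C.twoTorsionPolynomial =
      (C.baseChange Lbar).twoTorsionPolynomial := by
    change _ = (C.map (algebraMap L Lbar)).twoTorsionPolynomial
    simp only [twoTorsionPolynomial, Cubic.map, map_b₂, map_b₄, map_b₆, map_ofNat, map_mul]
  -- points of order `2` above each root, descended to `L` by (10), pushed to `L'`
  have key : ∀ e : L, algebraMap L Lbar e ∈ (Cubic.map (algebraMap L Lbar) C.twoTorsionPolynomial).roots →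
      ∃ T : (C.toAffine.baseChange L').Point, T ≠ 0 ∧ 2 • T = 0 ∧
        ∃ (y : Lbar) (h : (C.baseChange Lbar).toAffine.Nonsingular (algebraMap L Lbar e) y),
          j T = Affine.Point.some _ _ h := by
    intro e he
    rw [hmap] at he
    obtain ⟨y, hns, h2⟩ := (C.baseChange Lbar).exists_two_torsion_point_of_mem_roots he
    obtain ⟨T₀, hT₀⟩ := D.two_torsion_rational (Affine.Point.some _ _ hns) h2
    refine ⟨Affine.Point.baseChange (W' := C.toAffine) L L' T₀, ?_, ?_, y, hns, ?_⟩
    · intro h0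
      have h1 : j (Affine.Point.baseChange (W' := C.toAffine) L L' T₀) = 0 := by rw [h0, map_zero]
      rw [hj, Affine.Point.map_baseChange, hT₀] at h1
      exact Affine.Point.some_ne_zero _ h1
    · apply hjinj
      rw [map_nsmul, map_zero, hj, Affine.Point.map_baseChange, hT₀, ← natCast_zsmul, Nat.cast_ofNat]
      exact h2
    · rw [hj, Affine.Point.map_baseChange]
      exact hT₀
  obtain ⟨T₁, h₁0, h₁, y₁, hn₁, hT₁⟩ := key e₁ (by rw [h3]; simp)
  obtain ⟨T₂, h₂0, h₂, y₂, hn₂, hT₂⟩ := key e₂ (by rw [h3]; simp)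
  obtain ⟨T₃, h₃0, h₃, y₃, hn₃, hT₃⟩ := key e₃ (by rw [h3]; simp)
  refine exists_finset_card_four_of_two_torsion T₁ T₂ T₃ h₁ h₂ h₃ h₁0 h₂0 h₃0 ?_ ?_ ?_
  · rintro rfl
    rw [hT₁, Affine.Point.some.injEq] at hT₂
    exact h12 hT₂.1
  · rintro rfl
    rw [hT₁, Affine.Point.some.injEq] at hT₃
    exact h13 hT₃.1
  · rintro rfl
    rw [hT₂, Affine.Point.some.injEq] at hT₃
    exact h23 hT₃.1

/-- **`C(L')` has full `ℓ`-torsion**: `ℓ²` distinct points killed by `ℓ` (the `𝔽_ℓ`-basis `P, Q` of `C[ℓ](L̄)` of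
(12), descended to `L'` by (13), and its `ℤ`-span). Replay of the tree's
`Literature.IUT.HodgeTheaters.InitialThetaData.exists_finset_l_torsion`. [claim: Joshi2024ATS3, status: disputed] -/
theorem exists_finset_l_torsion [IsScalarTower L L' Lbar] :
    ∃ S : Finset (C.toAffine.baseChange L').Point, S.card = ℓ ^ 2 ∧ ∀ P ∈ S, ℓ • P = 0 := by
  obtain ⟨P, Q, hP, hQ, hind, -, -⟩ := D.imageContainsSL2.exists_basis
  obtain ⟨P₀, hP₀⟩ := D.mem_range_map_of_l_torsion P hP
  obtain ⟨Q₀, hQ₀⟩ := D.mem_range_map_of_l_torsion Q hQ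
  set ι := Affine.Point.map (W' := C.toAffine) (IsScalarTower.toAlgHom L L' Lbar) with hι
  have hιinj : Function.Injective ι := Affine.Point.map_injective _
  have hP₀l : (ℓ : ℤ) • P₀ = 0 := hιinj (by rw [map_zsmul, hP₀, map_zero, hP])
  have hQ₀l : (ℓ : ℤ) • Q₀ = 0 := hιinj (by rw [map_zsmul, hQ₀, map_zero, hQ])
  refine exists_finset_card_sq_of_independent D.prime.pos P₀ Q₀ hP₀l hQ₀l fun a b hab => hind a b ?_
  have h := congrArg ι hab
  rwa [map_add, map_zsmul, map_zsmul, hP₀, hQ₀, map_zero] at h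

end Torsion

/-! ## The `2ℓ`-th root of the Tate parameter at a place of split multiplicative reduction -/

section QRoot

open Literature.NumberTheory.EllipticCurves Literature.NumberTheory.EllipticCurves.TateCurve

variable {L : Type u} {L' : Type} {Lbar : Type w} [Field L] [NumberField L] [Field L'] [NumberField L']
  [Algebra L L'] [Field Lbar] [Algebra L Lbar] [Algebra L' Lbar] {C : WeierstrassCurve L} [C.IsElliptic]
  {ℓ : ℕ}

omit [NumberField L] [C.IsElliptic] in
/-- Transport of a finset of points killed by `n` along an EQUALITY of Weierstrass curves. [folklore] -/
private theorem exists_finset_torsion_of_eq {K : Type*} [Field K] {W₁ W₂ : WeierstrassCurve K} (h : W₁ = W₂)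
    {n : ℕ} (S : Finset W₁.toAffine.Point) (hS : ∀ P ∈ S, n • P = 0) :
    ∃ S' : Finset W₂.toAffine.Point, S'.card = S.card ∧ ∀ P ∈ S', n • P = 0 := by
  subst h
  exact ⟨S, rfl, hS⟩

omit [NumberField L] [C.IsElliptic] in
/-- Push-forward of a finset of `L'`-points killed by `n` to the completion `L'_w`, as points of
`(C ×_L L') ×_{L'} L'_w` (injective homomorphism `C(L') → C(L'_w)`; the curves `C ×_L L'_w` and
`(C ×_L L') ×_{L'} L'_w` coincide). Replay of the tree's private lemma of the same name. [folklore] -/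
private theorem exists_finset_torsion_completion (w : HeightOneSpectrum (𝓞 L')) {n : ℕ}
    (S : Finset (C.toAffine.baseChange L').Point) (hS : ∀ P ∈ S, n • P = 0) :
    ∃ S' : Finset ((C.baseChange L').baseChange (w.adicCompletion L')).toAffine.Point,
      S'.card = S.card ∧ ∀ P ∈ S', n • P = 0 := by
  let f : L' →ₐ[L] w.adicCompletion L' := IsScalarTower.toAlgHom L L' (w.adicCompletion L')
  let ι : (C.toAffine.baseChange L').Point →+ (C.toAffine.baseChange (w.adicCompletion L')).Point :=
    Affine.Point.map f
  have hι : Function.Injective ι := Affine.Point.map_injective f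
  have hEq : C.baseChange (w.adicCompletion L') = (C.baseChange L').baseChange (w.adicCompletion L') := by
    rw [WeierstrassCurve.baseChange, WeierstrassCurve.baseChange, WeierstrassCurve.baseChange,
      WeierstrassCurve.map_map, ← IsScalarTower.algebraMap_eq]
  obtain ⟨S', hS', hS'n⟩ := exists_finset_torsion_of_eq hEq (S.map ⟨ι, hι⟩) (by
    intro P hP
    obtain ⟨P₀, hP₀, rfl⟩ := Finset.mem_map.mp hP
    show n • ι P₀ = 0
    rw [← map_nsmul, hS P₀ hP₀, map_zero])
  exact ⟨S', by rw [hS', Finset.card_map], hS'n⟩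

variable (D : InitialThetaData L L' Lbar C ℓ)

include D

/-- **[J-III] §3.4.1, «the Tate parameter … has a `2ℓ`th-root in `L'_w`», GIVEN split multiplicative reduction at
`w`** (p.29 l.17–19; replay for Joshi's data of the tree's [IUTchI] Ex. 3.2 (iv) theorem
`Literature.IUT.HodgeTheaters.InitialThetaData.exists_pow_two_mul_l_eq_tateParameter`). For a finite place `w` of
`L'` at which `C ×_L L'` has SPLIT multiplicative reduction, the Tate parameter `q_w ∈ L'_w` (`q_w ≠ 0`, `‖q_w‖ < 1`,
`tateJ q_w = j(C)`) is `r ^ (2ℓ)` for some `r ∈ L'_w`, and `w(j(C)) = (w r)⁻¹ ^ (2ℓ)`. Inputs: `exists_finset_two_torsion`,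
`exists_finset_l_torsion` (this file), the tree's `exists_pow_eq_tateParameter_of_torsion_at`, `tateParameter_unique`,
`exists_pow_mul_eq_of_coprime`. PROVED (under `hsplit`). [claim: Joshi2024ATS3, status: disputed] -/
theorem exists_pow_two_mul_l_eq_tateParameter (w : HeightOneSpectrum (𝓞 L'))
    (hsplit : (C.baseChange L').HasSplitMultiplicativeReductionAt w) :
    ∃ q r : w.adicCompletion L', q ≠ 0 ∧ ‖q‖ < 1 ∧
      tateJ q = algebraMap L' (w.adicCompletion L') (C.baseChange L').j ∧ r ^ (2 * ℓ) = q ∧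
      Valued.v (algebraMap L' (w.adicCompletion L') (C.baseChange L').j) = ((Valued.v r)⁻¹) ^ (2 * ℓ) := by
  haveI := D.isScalarTower
  letI := Literature.NumberTheory.GaloisRepresentations.Ultrametric.AdicCompletion.nontriviallyNormedField L' w
  haveI := charZero_adicCompletion' L' w
  haveI : (C.baseChange L').IsElliptic := inferInstanceAs (C.map (algebraMap L L')).IsElliptic
  haveI : ((C.baseChange L').baseChange (w.adicCompletion L')).IsElliptic :=
    inferInstanceAs ((C.baseChange L').map (algebraMap L' (w.adicCompletion L'))).IsElliptic
  have hl : 0 < ℓ := D.prime.pos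
  -- the torsion over `L'_w`
  obtain ⟨S₂, hS₂, hS₂t⟩ := D.exists_finset_two_torsion
  obtain ⟨S₂', hS₂', hS₂'t⟩ := exists_finset_torsion_completion w S₂ hS₂t
  obtain ⟨Sl, hSl, hSlt⟩ := D.exists_finset_l_torsion
  obtain ⟨Sl', hSl', hSl't⟩ := exists_finset_torsion_completion w Sl hSlt
  -- a square root and an `ℓ`-th root of the Tate parameter
  obtain ⟨q, r₂, hq0, hq, hqj, hr₂, hv₂⟩ := exists_pow_eq_tateParameter_of_torsion_at L' w (C.baseChange L')
    hsplit two_pos S₂' hS₂'t (by rw [hS₂', hS₂]; norm_num)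
  obtain ⟨q', rl, hq0', hq', hqj', hrl, -⟩ := exists_pow_eq_tateParameter_of_torsion_at L' w (C.baseChange L')
    hsplit hl Sl' hSl't (by rw [hSl', hSl])
  have hj : ((C.baseChange L').baseChange (w.adicCompletion L')).j =
      algebraMap L' (w.adicCompletion L') (C.baseChange L').j := (C.baseChange L').map_j _
  have hqq : q' = q :=
    tateParameter_unique (E := (C.baseChange L').baseChange (w.adicCompletion L')) hq0' hq' (hqj'.trans hj.symm)
      hq0 hq (hqj.trans hj.symm)
  rw [hqq] at hrl
  -- combine: `gcd(2, ℓ) = 1`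
  have hcop : Nat.Coprime 2 ℓ := (Nat.coprime_primes Nat.prime_two D.prime).mpr (by
    have := D.five_le; omega)
  obtain ⟨r, hr⟩ := exists_pow_mul_eq_of_coprime hq0 hcop hr₂ hrl
  refine ⟨q, r, hq0, hq, hqj, hr, ?_⟩
  rw [hv₂, inv_pow, inv_pow, ← map_pow, ← map_pow, hr₂, hr]

/-- The same at a place of `L'` lying in the SPLIT-multiplicative locus `VoddSplitMod`'s analogue over `L'`: if
`C ×_L L'` has split multiplicative reduction at the maximal ideal of a finite place `w₀ ∈ V` (the gloss of (6)),
the Tate parameter in `L'_{w₀}` is a `2ℓ`-th power — the «in particular» of §3.4.1 in the tree's reading.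
[claim: Joshi2024ATS3, status: disputed] -/
theorem exists_root_tateParameter_of_split (w₀ : FinitePlace L')
    (hsplit : (C.baseChange L').HasSplitMultiplicativeReductionAt w₀.maximalIdeal) :
    ∃ q r : w₀.maximalIdeal.adicCompletion L', q ≠ 0 ∧ ‖q‖ < 1 ∧
      tateJ q = algebraMap L' _ (C.baseChange L').j ∧ r ^ (2 * ℓ) = q := by
  obtain ⟨q, r, hq0, hq, hqj, hr, -⟩ := D.exists_pow_two_mul_l_eq_tateParameter w₀.maximalIdeal hsplit
  exact ⟨q, r, hq0, hq, hqj, hr⟩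

end QRoot

end Summit.ABC.IUTFork.Joshi.ATS3.InitialThetaData

end
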